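import Literature.NumberTheory.LFunctions.Zhang2022.Section8FrontEnd82
import Literature.NumberTheory.LFunctions.Zhang2022.RepairGapLemma82LeafPremise
import Literature.NumberTheory.LFunctions.Zhang2022.RepairGapPartIIIDoors
import HarnessLib

/-!
# Zhang (2022), rescue GAP/BED (D-0124 (3)(4)): §8 p. 47 — the two applications of Lemma 8.2 inside `S_j(𝐚₁₁,𝐚₂₁)`
# (nodes Z22:§8.u040 / u041, front end of the (8.23) chain) under the minimum premise `‖L(1,χ)‖ ≤ 𝓛⁻¹⁵`

Topic `Literature/NumberTheory/LFunctions/Zhang2022` (Landau–Siegel audit tree; verdict-neutral).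
Y. Zhang, *Discrete mean estimates and the Landau–Siegel zero*, arXiv:2211.02515v1 (2022)
[Zhang2022LandauSiegel] — **an unrefereed manuscript under adjudication; nothing in this file asserts or
denies its Theorems 1–2, and nothing here is a claim about Landau–Siegel zeros. The programme SEARCHES and
TYPES; no claim about Landau–Siegel zeros, Theorems 1–2 of arXiv:2211.02515 or a repaired Margin232 until a
kernel theorem says so.**

The typed nodes `Section8cStatements.Step8u040 c′` / `Step8u041 c′` («By Lemma 8.2 with `x = P₁/dr` … and `x = P₂/dr`
respectively», tex L2421–L2427) are tree theorems (`Section8FrontEnd82.step8u040_holds` / `step8u041_holds`) whose only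
(A)-input is the Lemma 8.2 LEAF (`Skeleton.lemma82_holds`); that leaf is kernel under `‖L(1,χ)‖ ≤ 𝓛⁻¹⁵`
(`Skeleton.lemma82_pow15`, p592479). This file re-runs the two proofs VERBATIM with `lemma82_holds ↦ lemma82_pow15` and the
guard of the conclusion swapped: `step8u040_pow15`, `step8u041_pow15` (same constants `2C₈₂`, `4C₈₂`), plus the transfers
`…_of_assumptionAWith` (every real `E ≥ 15`; at `E = 2022` the bodies of the tree nodes, not restated). Consumers in the
tree (for orientation, not re-keyed here): `Section8Ded823Final` ((8.23)), `Section10Range1113LowRel`, `Section10cLow1214Eval`,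
`Section12Top1225ExHolds`. Theorems only; no definition, no named fact; nothing about (A) itself.

## References

* Y. Zhang, arXiv:2211.02515v1 (2022), §8 p. 47 (tex L2420–L2427), Lemma 8.2 p. 45, (8.6).
  [cite: Zhang2022LandauSiegel, §8 p.47]
-/

noncomputable section

open Complex Real Finset

namespace Literature.NumberTheory.LFunctions.Zhang2022.Section8FrontEnd82

open Complex Real ComplexConjugate Finset
open Literature.NumberTheory.LFunctions.Zhang2022.Skeleton
open Literature.NumberTheory.LFunctions.Zhang2022.Repair.Bed (AssumptionAWith)

/-- **`Z22:§8.u040` UNDER THE MINIMUM PREMISE** (twin of `step8u040_holds`, constant `2C₈₂`): for `c′ ≥ 0`, all large `D`,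
every real primitive `χ` with `‖L(1,χ)‖ ≤ 𝓛⁻¹⁵`, `1 ≤ j ≤ 3`, `dr < P₁/T`:
`Σ_m χ(m)ϰ₁(drm)/m^{1−β_j} = (L′(1,χ)/log P₁)𝓕_{j6}(P₁/dr) + O(𝓛⁻¹⁵)` — Lemma 8.2 at `𝓛⁻¹⁵` (`Skeleton.lemma82_pow15`) with
`x = P₁/dr`. [cite: Zhang2022LandauSiegel, §8 p.47, tex L2421] -/
theorem step8u040_pow15 {c' : ℝ} (hc' : 0 ≤ c') :
    ∃ C : ℝ, ForAllLarge fun D _ χ => ‖χ.LFunction 1‖ ≤ 1 / Real.log D ^ 15 →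
      ∀ j ∈ ({1, 2, 3} : Finset ℕ), ∀ d r : ℕ, 1 ≤ d → 1 ≤ r →
        ((d * r : ℕ) : ℝ) < Skeleton.P1 D / bigT D →
          ‖(∑ m ∈ Finset.Ico 1 (Nsupp D),
                χ (m : ZMod D) * vk1 D (d * r * m) / (m : ℂ) ^ (1 - betaJ c' D j)) -
              deriv χ.LFunction 1 / (Real.log (Skeleton.P1 D) : ℂ) *
                frakfW c' D j 6 (Skeleton.P1 D / ((d * r : ℕ) : ℝ))‖
            ≤ C * (ell D ^ 15)⁻¹ := by
  obtain ⟨C, D₀, h82⟩ := lemma82_pow15 hc'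
  refine ⟨2 * C, max D₀ ⌈Real.exp 2⌉₊, fun D _ χ hD hq hp hA j hj d r hd hr hdr => ?_⟩
  have hD₀ : D₀ ≤ D := le_trans (le_max_left _ _) hD
  have hL : 2 ≤ ell D := two_le_ell (le_trans (le_max_right _ _) hD)
  obtain ⟨hlogP1, -, hP1PT, -, hP1T, -, hP1P, -⟩ := params hL
  have hL0 : 0 < ell D := by linarith
  have hT0 : 0 < bigT D := Real.exp_pos _
  have hdr1 : 1 ≤ d * r := Nat.one_le_iff_ne_zero.mpr (Nat.mul_ne_zero (by omega) (by omega))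
  have hdr0 : (0 : ℝ) < ((d * r : ℕ) : ℝ) := by exact_mod_cast hdr1
  set x : ℝ := Skeleton.P1 D / ((d * r : ℕ) : ℝ) with hx
  have hP1x : Skeleton.P1 D = ((d * r : ℕ) : ℝ) * x := by rw [hx]; field_simp
  have hxT : bigT D < x := by
    rw [hx, lt_div_iff₀ hdr0]; rw [lt_div_iff₀ hT0] at hdr; linarith
  have hP1pos : 0 < Skeleton.P1 D := Real.rpow_pos_of_pos (Real.exp_pos _) _
  have hxle : x ≤ Skeleton.P1 D := div_le_self hP1pos.le (by exact_mod_cast hdr1)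
  have hxP : x < bigP D := lt_of_le_of_lt hxle hP1P
  have hT1 : 1 < bigT D := by
    rw [bigT]; exact Real.one_lt_exp_iff.mpr (by positivity)
  have hP1one : 1 < Skeleton.P1 D := lt_of_lt_of_le (lt_trans hT1 hxT) hxle
  have key := h82 D χ hD₀ hq hp hA j hj 6 (by simp) x hxT hxP
  have hC0 : 0 ≤ C := by
    have := (norm_nonneg _).trans key
    have h6 : 0 < (ell D ^ 6)⁻¹ := by positivity
    nlinarith
  -- the sum of `S_j` is `(log P₁)⁻¹ ×` the sum of Lemma 8.2
  have hsub : Finset.Ico 1 ⌈x⌉₊ ⊆ Finset.Ico 1 (Nsupp D) := Ico_ceil_subset hP1PT hdr1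
  have hsum : (∑ m ∈ Finset.Ico 1 (Nsupp D),
        χ (m : ZMod D) * vk1 D (d * r * m) / (m : ℂ) ^ (1 - betaJ c' D j)) =
      (1 / (Real.log (Skeleton.P1 D) : ℂ)) *
        ∑ m ∈ Finset.Ico 1 ⌈x⌉₊, χ (m : ZMod D) / (m : ℂ) ^ (1 - betaJ c' D j) *
          ((x / m : ℝ) : ℂ) ^ betaMu D 6 * (Real.log (x / m) : ℂ) := by
    rw [Finset.mul_sum]
    symm
    apply Finset.sum_subset_zero_on_sdiff hsub
    · intro m hm
      rw [Finset.mem_sdiff, Finset.mem_Ico, Finset.mem_Ico, not_and, not_lt] at hm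
      have hxm : x ≤ m := Nat.ceil_le.mp (hm.2 hm.1.1)
      have hm1 : (1 : ℝ) ≤ m := by exact_mod_cast hm.1.1
      have : Skeleton.P1 D ≤ ((d * r * m : ℕ) : ℝ) := by
        rw [hP1x]; push_cast
        exact mul_le_mul_of_nonneg_left hxm (by positivity)
      rw [vk1_mul_eq_zero this, mul_zero, zero_div]
    · intro m hm
      rw [Finset.mem_Ico] at hm
      have hm1 : 1 ≤ m := hm.1
      have hmx : (m : ℝ) < x := Nat.lt_ceil.mp hm.2
      have hm0 : (0 : ℝ) < m := by exact_mod_cast hm1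
      have hdrm : ((d * r * m : ℕ) : ℝ) < Skeleton.P1 D := by
        rw [hP1x]; push_cast
        have := mul_lt_mul_of_pos_left hmx hdr0
        push_cast at this; linarith
      rw [vk1_mul_eq hP1one hdr1 hm1 hdrm]
      have hb : betaMu D 6 = beta6 D := by simp [betaMu]
      rw [hb, show Skeleton.P1 D / ((d * r : ℕ) : ℝ) / m = x / m by rw [hx]]
      ring
  have hlog0 : 0 < Real.log (Skeleton.P1 D) := by rw [hlogP1]; positivity
  rw [hsum, show (1 / (Real.log (Skeleton.P1 D) : ℂ)) *
        (∑ m ∈ Finset.Ico 1 ⌈x⌉₊, χ (m : ZMod D) / (m : ℂ) ^ (1 - betaJ c' D j) *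
          ((x / m : ℝ) : ℂ) ^ betaMu D 6 * (Real.log (x / m) : ℂ)) -
        deriv χ.LFunction 1 / (Real.log (Skeleton.P1 D) : ℂ) * frakfW c' D j 6 x =
      (1 / (Real.log (Skeleton.P1 D) : ℂ)) *
        ((∑ m ∈ Finset.Ico 1 ⌈x⌉₊, χ (m : ZMod D) / (m : ℂ) ^ (1 - betaJ c' D j) *
          ((x / m : ℝ) : ℂ) ^ betaMu D 6 * (Real.log (x / m) : ℂ)) -
          deriv χ.LFunction 1 * frakfW c' D j 6 x) by ring, norm_mul]
  have hn : ‖(1 / (Real.log (Skeleton.P1 D) : ℂ))‖ = 1 / Real.log (Skeleton.P1 D) := by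
    rw [norm_div, norm_one, Complex.norm_real, Real.norm_eq_abs, abs_of_pos hlog0]
  rw [hn]
  calc 1 / Real.log (Skeleton.P1 D) * ‖(∑ m ∈ Finset.Ico 1 ⌈x⌉₊,
          χ (m : ZMod D) / (m : ℂ) ^ (1 - betaJ c' D j) * ((x / m : ℝ) : ℂ) ^ betaMu D 6 *
            (Real.log (x / m) : ℂ)) - deriv χ.LFunction 1 * frakfW c' D j 6 x‖
      ≤ 1 / Real.log (Skeleton.P1 D) * (C * (ell D ^ 6)⁻¹) :=
        mul_le_mul_of_nonneg_left key (by positivity)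
    _ = C / 0.504 * (ell D ^ 15)⁻¹ := by rw [hlogP1]; field_simp
    _ ≤ 2 * C * (ell D ^ 15)⁻¹ := by
        apply mul_le_mul_of_nonneg_right _ (by positivity)
        rw [div_le_iff₀ (by norm_num)]; nlinarith

/-- **`Z22:§8.u041` UNDER THE MINIMUM PREMISE** (twin of `step8u041_holds`, constant `4C₈₂`): the same with `ϰ₂`, `P₂`,
`𝓕_{j7}`, `x = P₂/dr`. [cite: Zhang2022LandauSiegel, §8 p.47, tex L2427] -/
theorem step8u041_pow15 {c' : ℝ} (hc' : 0 ≤ c') :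
    ∃ C : ℝ, ForAllLarge fun D _ χ => ‖χ.LFunction 1‖ ≤ 1 / Real.log D ^ 15 →
      ∀ j ∈ ({1, 2, 3} : Finset ℕ), ∀ d r : ℕ, 1 ≤ d → 1 ≤ r →
        ((d * r : ℕ) : ℝ) < Skeleton.P2 D / bigT D →
          ‖(∑ m ∈ Finset.Ico 1 (Nsupp D),
                χ (m : ZMod D) * vk2 D (d * r * m) / (m : ℂ) ^ (1 - betaJ c' D j)) -
              deriv χ.LFunction 1 / (Real.log (Skeleton.P2 D) : ℂ) *
                frakfW c' D j 7 (Skeleton.P2 D / ((d * r : ℕ) : ℝ))‖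
            ≤ C * (ell D ^ 15)⁻¹ := by
  obtain ⟨C, D₀, h82⟩ := lemma82_pow15 hc'
  refine ⟨4 * C, max D₀ ⌈Real.exp 2⌉₊, fun D _ χ hD hq hp hA j hj d r hd hr hdr => ?_⟩
  have hD₀ : D₀ ≤ D := le_trans (le_max_left _ _) hD
  have hL : 2 ≤ ell D := two_le_ell (le_trans (le_max_right _ _) hD)
  obtain ⟨-, hlogP2, -, hP2PT, -, hP2T, -, hP2P⟩ := params hL
  have hL0 : 0 < ell D := by linarith
  have hT0 : 0 < bigT D := Real.exp_pos _
  have hdr1 : 1 ≤ d * r := Nat.one_le_iff_ne_zero.mpr (Nat.mul_ne_zero (by omega) (by omega))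
  have hdr0 : (0 : ℝ) < ((d * r : ℕ) : ℝ) := by exact_mod_cast hdr1
  set x : ℝ := Skeleton.P2 D / ((d * r : ℕ) : ℝ) with hx
  have hP2x : Skeleton.P2 D = ((d * r : ℕ) : ℝ) * x := by rw [hx]; field_simp
  have hxT : bigT D < x := by
    rw [hx, lt_div_iff₀ hdr0]; rw [lt_div_iff₀ hT0] at hdr; linarith
  have hP2pos : 0 < Skeleton.P2 D :=
    div_pos (Real.rpow_pos_of_pos (Real.exp_pos _) _) (pow_pos (Real.exp_pos _) _)
  have hxle : x ≤ Skeleton.P2 D := div_le_self hP2pos.le (by exact_mod_cast hdr1)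
  have hxP : x < bigP D := lt_of_le_of_lt hxle hP2P
  have hT1 : 1 < bigT D := by
    rw [bigT]; exact Real.one_lt_exp_iff.mpr (by positivity)
  have hP2one : 1 < Skeleton.P2 D := lt_of_lt_of_le (lt_trans hT1 hxT) hxle
  have key := h82 D χ hD₀ hq hp hA j hj 7 (by simp) x hxT hxP
  have hC0 : 0 ≤ C := by
    have := (norm_nonneg _).trans key
    have h6 : 0 < (ell D ^ 6)⁻¹ := by positivity
    nlinarith
  -- the sum of `S_j` is `(log P₁)⁻¹ ×` the sum of Lemma 8.2
  have hsub : Finset.Ico 1 ⌈x⌉₊ ⊆ Finset.Ico 1 (Nsupp D) := Ico_ceil_subset hP2PT hdr1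
  have hsum : (∑ m ∈ Finset.Ico 1 (Nsupp D),
        χ (m : ZMod D) * vk2 D (d * r * m) / (m : ℂ) ^ (1 - betaJ c' D j)) =
      (1 / (Real.log (Skeleton.P2 D) : ℂ)) *
        ∑ m ∈ Finset.Ico 1 ⌈x⌉₊, χ (m : ZMod D) / (m : ℂ) ^ (1 - betaJ c' D j) *
          ((x / m : ℝ) : ℂ) ^ betaMu D 7 * (Real.log (x / m) : ℂ) := by
    rw [Finset.mul_sum]
    symm
    apply Finset.sum_subset_zero_on_sdiff hsub
    · intro m hm
      rw [Finset.mem_sdiff, Finset.mem_Ico, Finset.mem_Ico, not_and, not_lt] at hm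
      have hxm : x ≤ m := Nat.ceil_le.mp (hm.2 hm.1.1)
      have hm1 : (1 : ℝ) ≤ m := by exact_mod_cast hm.1.1
      have : Skeleton.P2 D ≤ ((d * r * m : ℕ) : ℝ) := by
        rw [hP2x]; push_cast
        exact mul_le_mul_of_nonneg_left hxm (by positivity)
      rw [vk2_mul_eq_zero this, mul_zero, zero_div]
    · intro m hm
      rw [Finset.mem_Ico] at hm
      have hm1 : 1 ≤ m := hm.1
      have hmx : (m : ℝ) < x := Nat.lt_ceil.mp hm.2
      have hm0 : (0 : ℝ) < m := by exact_mod_cast hm1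
      have hdrm : ((d * r * m : ℕ) : ℝ) < Skeleton.P2 D := by
        rw [hP2x]; push_cast
        have := mul_lt_mul_of_pos_left hmx hdr0
        push_cast at this; linarith
      rw [vk2_mul_eq hP2one hdr1 hm1 hdrm]
      have hb : betaMu D 7 = beta7 D := by simp [betaMu]
      rw [hb, show Skeleton.P2 D / ((d * r : ℕ) : ℝ) / m = x / m by rw [hx]]
      ring
  have hlog0 : 0 < Real.log (Skeleton.P2 D) := lt_of_lt_of_le (by positivity) hlogP2
  rw [hsum, show (1 / (Real.log (Skeleton.P2 D) : ℂ)) *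
        (∑ m ∈ Finset.Ico 1 ⌈x⌉₊, χ (m : ZMod D) / (m : ℂ) ^ (1 - betaJ c' D j) *
          ((x / m : ℝ) : ℂ) ^ betaMu D 7 * (Real.log (x / m) : ℂ)) -
        deriv χ.LFunction 1 / (Real.log (Skeleton.P2 D) : ℂ) * frakfW c' D j 7 x =
      (1 / (Real.log (Skeleton.P2 D) : ℂ)) *
        ((∑ m ∈ Finset.Ico 1 ⌈x⌉₊, χ (m : ZMod D) / (m : ℂ) ^ (1 - betaJ c' D j) *
          ((x / m : ℝ) : ℂ) ^ betaMu D 7 * (Real.log (x / m) : ℂ)) -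
          deriv χ.LFunction 1 * frakfW c' D j 7 x) by ring, norm_mul]
  have hn : ‖(1 / (Real.log (Skeleton.P2 D) : ℂ))‖ = 1 / Real.log (Skeleton.P2 D) := by
    rw [norm_div, norm_one, Complex.norm_real, Real.norm_eq_abs, abs_of_pos hlog0]
  rw [hn]
  have hL9 : 0 < ell D ^ 9 := by positivity
  have hinv : 1 / Real.log (Skeleton.P2 D) ≤ 4 / ell D ^ 9 := by
    rw [div_le_div_iff₀ hlog0 hL9]; linarith
  calc 1 / Real.log (Skeleton.P2 D) * ‖(∑ m ∈ Finset.Ico 1 ⌈x⌉₊,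
          χ (m : ZMod D) / (m : ℂ) ^ (1 - betaJ c' D j) * ((x / m : ℝ) : ℂ) ^ betaMu D 7 *
            (Real.log (x / m) : ℂ)) - deriv χ.LFunction 1 * frakfW c' D j 7 x‖
      ≤ 4 / ell D ^ 9 * (C * (ell D ^ 6)⁻¹) :=
        mul_le_mul hinv key (norm_nonneg _) (by positivity)
    _ = 4 * C * (ell D ^ 15)⁻¹ := by field_simp

/-- `Z22:§8.u040` under `Repair.Bed.AssumptionAWith E`, every real `E ≥ 15` (transfer; at `E = 2022` the body of
`Section8cStatements.Step8u040 c′`, i.e. of the tree theorem `step8u040_holds`, not restated). [cite: Zhang2022LandauSiegel, §8 p.47] -/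
theorem step8u040_of_assumptionAWith {c' : ℝ} (hc' : 0 ≤ c') {E : ℝ} (hE : 15 ≤ E) :
    ∃ C : ℝ, ForAllLarge fun D _ χ => AssumptionAWith E D χ →
      ∀ j ∈ ({1, 2, 3} : Finset ℕ), ∀ d r : ℕ, 1 ≤ d → 1 ≤ r →
        ((d * r : ℕ) : ℝ) < Skeleton.P1 D / bigT D →
          ‖(∑ m ∈ Finset.Ico 1 (Nsupp D),
                χ (m : ZMod D) * vk1 D (d * r * m) / (m : ℂ) ^ (1 - betaJ c' D j)) -
              deriv χ.LFunction 1 / (Real.log (Skeleton.P1 D) : ℂ) *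
                frakfW c' D j 6 (Skeleton.P1 D / ((d * r : ℕ) : ℝ))‖
            ≤ C * (ell D ^ 15)⁻¹ := by
  obtain ⟨C, h⟩ := step8u040_pow15 hc'
  exact ⟨C, Repair.Gap.forAllLarge_assumptionAWith_of_pow15 hE h⟩

/-- `Z22:§8.u041` under `Repair.Bed.AssumptionAWith E`, every real `E ≥ 15` (transfer; at `E = 2022` the body of
`Section8cStatements.Step8u041 c′`, not restated). [cite: Zhang2022LandauSiegel, §8 p.47] -/
theorem step8u041_of_assumptionAWith {c' : ℝ} (hc' : 0 ≤ c') {E : ℝ} (hE : 15 ≤ E) :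
    ∃ C : ℝ, ForAllLarge fun D _ χ => AssumptionAWith E D χ →
      ∀ j ∈ ({1, 2, 3} : Finset ℕ), ∀ d r : ℕ, 1 ≤ d → 1 ≤ r →
        ((d * r : ℕ) : ℝ) < Skeleton.P2 D / bigT D →
          ‖(∑ m ∈ Finset.Ico 1 (Nsupp D),
                χ (m : ZMod D) * vk2 D (d * r * m) / (m : ℂ) ^ (1 - betaJ c' D j)) -
              deriv χ.LFunction 1 / (Real.log (Skeleton.P2 D) : ℂ) *
                frakfW c' D j 7 (Skeleton.P2 D / ((d * r : ℕ) : ℝ))‖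
            ≤ C * (ell D ^ 15)⁻¹ := by
  obtain ⟨C, h⟩ := step8u041_pow15 hc'
  exact ⟨C, Repair.Gap.forAllLarge_assumptionAWith_of_pow15 hE h⟩

end Literature.NumberTheory.LFunctions.Zhang2022.Section8FrontEnd82

end
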